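import Literature.AlgebraicGeometry.HodgeTheory.GysinCleanBaseChange
import Literature.AlgebraicGeometry.HodgeTheory.CrossProductTopClass
import Literature.AlgebraicGeometry.HodgeTheory.DiagonalClassLefschetzTraceFormula
import HarnessLib

/-!
# The class of the diagonal of a product: `cl(Δ_{X×Y}) = C · p₁₃^* cl(Δ_X) ∪ p₂₄^* cl(Δ_Y)`, `C ≠ 0`

Family `hodge`, layer `Literature/AlgebraicGeometry/HodgeTheory`; lane `lit-hodgefound`. THEOREMS ONLY
(no definition, no named fact; D-0026), on the tree's carriers `diagonalClass hX = Δ_* 1 ∈ H²ⁿ((X ⊗ X)(ℂ); ℂ)`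
(complex orientations, file `AbsoluteHodgeClassesKunnethLefschetz`) and the Gysin morphisms
`complexGysin` (Fulton, *Young Tableaux* App. B; file `ComplexGysin`).

For smooth projective complex `X` (dimension `m`) and `Y` (dimension `n`) write
`T = (X ⊗ Y) ⊗ (X ⊗ Y)`, `p₁₃ = fst ⊗ fst : T ⟶ X ⊗ X`, `p₂₄ = snd ⊗ snd : T ⟶ Y ⊗ Y`. Classically
(W. Fulton, *Intersection Theory* (1998), Ex. 8.4.2 / Prop. 8.1.1 with §19.2, and Ex. 16.1.11:
`[Δ_{X×Y}] = p₁₃^*[Δ_X] · p₂₄^*[Δ_Y]`, the transversal intersection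
`Δ_{X×Y} = p₁₃⁻¹Δ_X ∩ p₂₄⁻¹Δ_Y`; B. Kahn, *Zeta and L-functions of varieties and motives* (2020) §6.9
proof of Lemma 6.30 (3): "`p^k_{M⊗N} = Σ_{i+j=k} p^i_M ⊗ p^j_N`"). The tree fixes the complex
orientation of each `X(ℂ)` only up to a unit per dimension (`ComplexOrientationFamily`), so identities
mixing the orientations of `X ⊗ X`, `Y ⊗ Y`, `X ⊗ Y` and `T` hold up to ONE non-zero scalar — the shape
of the tree's base-change theorems `complexGysin_cleanBaseChange` / `gysin_baseChange_of_kunneth`.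

## What is proved

* §1 Geometry of the three "partial diagonals" — the closed immersions
  `ι₁ : X ⊗ (Y ⊗ Y) ⟶ T`, `(x, y₁, y₂) ↦ ((x, y₁), (x, y₂))` (`= p₁₃⁻¹Δ_X`),
  `ι₂ : (X ⊗ X) ⊗ Y ⟶ T`, `((x₁, x₂), y) ↦ ((x₁, y), (x₂, y))` (`= p₂₄⁻¹Δ_Y`), their retractions,
  and the fibre squares `p₁₃⁻¹Δ_X`, `p₂₄⁻¹Δ_Y`, `ι₁⁻¹(ι₂) = Δ_{X⊗Y}` on complex points
  (`incidence_p13`, `incidence_p24`, `incidence_iota`), all written inline with `lift`, `◁`, `▷`.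
* §2 **`exists_map_p13_diagonalClass_eq_smul`**, **`exists_map_p24_diagonalClass_eq_smul`** —
  `p₁₃^* cl(Δ_X) = K₁ · ι₁_* 1`, `p₂₄^* cl(Δ_Y) = K₂ · ι₂_* 1` (clean base change, Fulton Thm. 6.2 (a));
  **`exists_gysin_iota_one_cup_eq_smul_diagonalClass`** — `ι₂_* 1 ∪ ι₁_* 1 = K₃ · cl(Δ_{X⊗Y})`
  (projection formula for `ι₁`, clean base change for the square `ι₁⁻¹(ι₂) = Δ`, functoriality).
* §3 `cupProduct_map_fst_map_snd_ne_zero_of_ne_zero` — a cross product of non-zero classes is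
  non-zero (Poincaré duality on the second factor and the tree's top-degree case
  `cupProduct_map_fst_map_snd_ne_zero`); `diagonalClass_ne_zero`.
* §4 **`exists_p13_diagonalClass_cup_p24_diagonalClass_eq_smul`** —
  `p₁₃^* cl(Δ_X) ∪ p₂₄^* cl(Δ_Y) = C · cl(Δ_{X⊗Y})` with `C ≠ 0`, and the inverse form
  **`exists_diagonalClass_tensor_eq_smul`** — `cl(Δ_{X⊗Y}) = c · p₁₃^* cl(Δ_X) ∪ p₂₄^* cl(Δ_Y)`, `c ≠ 0`
  (`C ≠ 0` because the left side is the pull-back, along the shuffle isomorphism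
  `T ≅ (X ⊗ X) ⊗ (Y ⊗ Y)`, of the non-zero cross product `cl(Δ_X) × cl(Δ_Y)`).

Sequel: the Künneth components of `cl(Δ_{X⊗Y})` are `c · Σ_{i+j=k} p₁₃^* π_X^i ∪ p₂₄^* π_Y^j`, whence
`C(X) ∧ C(Y) ⟹ C(X × Y)` (file `KunnethStandardConjectureProducts`).

## References

* [Fulton1998] W. Fulton, Intersection Theory, 2nd ed., Springer 1998, Prop. 1.7, Thm. 6.2 (a),
  Prop. 8.1.1, Ex. 8.4.2, §16.1 Ex. 16.1.11, §19.2.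
* [Kahn2020] B. Kahn, Zeta and L-functions of varieties and motives, CUP 2020, §6.9 proof of
  Lemma 6.30 (3) (p. 125).
* [FultonYoungTableaux1997] W. Fulton, Young Tableaux, CUP 1997, Appendix B §B.1 (2)–(7).
* [HatcherAT2002] A. Hatcher, Algebraic Topology, CUP 2002, §3.2 Prop. 3.10, Thm. 3.16; §3.3 Prop. 3.38.
-/

noncomputable section

open CategoryTheory AlgebraicGeometry MonoidalCategory CartesianMonoidalCategory
open Literature.AlgebraicTopology.SingularHomology
open Literature.AlgebraicGeometry.Motives (IsSmoothProjective ComplexPoints AlgPoints)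

namespace Literature.AlgebraicGeometry.HodgeTheory

variable {m n : ℕ} {X Y : Motives.SchemeOver ℂ}

/-! ### §1 The partial diagonals `ι₁ = p₁₃⁻¹Δ_X`, `ι₂ = p₂₄⁻¹Δ_Y` and their fibre squares -/

section Geometry

variable (X Y)

/-- `ι₁ ≫ r₁ = 𝟙`: `(x, y₁, y₂) ↦ ((x, y₁), (x, y₂)) ↦ (x, (y₁, y₂))`. [cite: Fulton1998, Prop. 1.7] -/
@[reassoc]
theorem iota₁_comp_retraction :
    lift (X ◁ fst Y Y) (X ◁ snd Y Y) ≫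
        lift (fst (X ⊗ Y) (X ⊗ Y) ≫ fst X Y)
          (lift (fst (X ⊗ Y) (X ⊗ Y) ≫ snd X Y) (snd (X ⊗ Y) (X ⊗ Y) ≫ snd X Y)) =
      𝟙 (X ⊗ (Y ⊗ Y)) := by
  ext <;> simp

/-- `ι₂ ≫ r₂ = 𝟙`: `((x₁, x₂), y) ↦ ((x₁, y), (x₂, y)) ↦ ((x₁, x₂), y)`. [cite: Fulton1998, Prop. 1.7] -/
@[reassoc]
theorem iota₂_comp_retraction :
    lift (fst X X ▷ Y) (snd X X ▷ Y) ≫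
        lift (lift (fst (X ⊗ Y) (X ⊗ Y) ≫ fst X Y) (snd (X ⊗ Y) (X ⊗ Y) ≫ fst X Y))
          (fst (X ⊗ Y) (X ⊗ Y) ≫ snd X Y) =
      𝟙 ((X ⊗ X) ⊗ Y) := by
  ext <;> simp

/-- `q₃ ≫ (fst ▷ Y) = 𝟙`: `(x, y) ↦ ((x, x), y) ↦ (x, y)`. [cite: Fulton1998, Prop. 1.7] -/
@[reassoc]
theorem diagFst_comp_retraction :
    lift (lift (fst X Y) (fst X Y)) (snd X Y) ≫ (fst X X ▷ Y) = 𝟙 (X ⊗ Y) := by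
  ext <;> simp

/-- `p₃ ≫ ι₁ = Δ_{X⊗Y}`: `(x, y) ↦ (x, (y, y)) ↦ ((x, y), (x, y))`. [cite: Fulton1998, §16.1 Ex. 16.1.11] -/
@[reassoc]
theorem diagSnd_comp_iota₁ :
    lift (fst X Y) (lift (snd X Y) (snd X Y)) ≫ lift (X ◁ fst Y Y) (X ◁ snd Y Y) =
      lift (𝟙 (X ⊗ Y)) (𝟙 (X ⊗ Y)) := by
  ext <;> simp

variable {X Y}

/-- A morphism of smooth projective `ℂ`-varieties with a retraction is a closed immersion (it is a
section of the separated retraction). [cite: Fulton1998, Prop. 1.7] -/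
theorem isClosedImmersion_left_of_retraction {a b : ℕ} {A B : Motives.SchemeOver ℂ}
    (hA : IsSmoothProjective a A) (hB : IsSmoothProjective b B) (i : A ⟶ B) (r : B ⟶ A)
    (h : i ≫ r = 𝟙 A) : IsClosedImmersion i.left := by
  haveI : IsProper r.left := isProper_left_of_isSmoothProjective hB hA r
  haveI : IsClosedImmersion (i.left ≫ r.left) := by
    rw [← Over.comp_left, h]
    exact inferInstanceAs (IsClosedImmersion (𝟙 A.left))
  exact IsClosedImmersion.of_comp i.left r.left

/-- `(q, p) : W ⟶ Y ⊗ X'` is a closed immersion as soon as `p` is one and `Y` is smooth projective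
(hence separated over `ℂ`): `(q, p) ≫ snd = p` with `snd` separated (the mirror image of the tree's
`isClosedImmersion_lift_left_of_isSmoothProjective`). [cite: Fulton1998, Prop. 1.7 and §16.1] -/
theorem isClosedImmersion_lift_left_of_isClosedImmersion_right {W Y' X' : Motives.SchemeOver ℂ}
    (hY' : IsSmoothProjective m Y') (q : W ⟶ Y') (p : W ⟶ X') [IsClosedImmersion p.left] :
    IsClosedImmersion (lift q p).left := by
  haveI : IsProper Y'.hom := Motives.IsSmoothProjective.isProper_holds hY'
  have h : (lift q p).left ≫ (snd Y' X').left = p.left := by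
    rw [← Over.comp_left, lift_snd]
  haveI : IsSeparated (snd Y' X').left :=
    inferInstanceAs (IsSeparated (Limits.pullback.snd Y'.hom X'.hom))
  haveI : IsClosedImmersion ((lift q p).left ≫ (snd Y' X').left) := by
    rw [h]
    infer_instance
  exact IsClosedImmersion.of_comp _ (snd Y' X').left

/-- **The fibre square `p₁₃⁻¹Δ_X = ι₁(X ⊗ (Y ⊗ Y))` on complex points**: if `Δ_X(P) = p₁₃(Q)` then
`Q = ι₁(R)` with `R = (P, p₂₄ Q)` and `fst R = P`. [cite: Fulton1998, Prop. 1.7 and Ex. 8.4.2] -/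
theorem incidence_p13 (P : ComplexPoints X) (Q : ComplexPoints ((X ⊗ Y) ⊗ (X ⊗ Y)))
    (h : AlgPoints.map (lift (𝟙 X) (𝟙 X)) P = AlgPoints.map (fst X Y ⊗ₘ fst X Y) Q) :
    ∃ R : ComplexPoints (X ⊗ (Y ⊗ Y)), AlgPoints.map (fst X (Y ⊗ Y)) R = P ∧
      AlgPoints.map (lift (X ◁ fst Y Y) (X ◁ snd Y Y)) R = Q := by
  simp only [AlgPoints.map_apply] at h ⊢
  have e1 : P = Q ≫ fst _ _ ≫ fst X Y := by simpa using congrArg (· ≫ fst X X) h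
  have e2 : P = Q ≫ snd _ _ ≫ fst X Y := by simpa using congrArg (· ≫ snd X X) h
  have e3 : Q ≫ snd _ _ ≫ fst X Y = Q ≫ fst _ _ ≫ fst X Y := e2.symm.trans e1
  refine ⟨lift P (Q ≫ (snd X Y ⊗ₘ snd X Y)), by simp, ?_⟩
  apply CartesianMonoidalCategory.hom_ext
  · apply CartesianMonoidalCategory.hom_ext
    · simp [e1]
    · simp
  · apply CartesianMonoidalCategory.hom_ext
    · simp [e1, e3]
    · simp

/-- **The fibre square `p₂₄⁻¹Δ_Y = ι₂((X ⊗ X) ⊗ Y)` on complex points.** [cite: Fulton1998, Prop. 1.7 and Ex. 8.4.2] -/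
theorem incidence_p24 (P : ComplexPoints Y) (Q : ComplexPoints ((X ⊗ Y) ⊗ (X ⊗ Y)))
    (h : AlgPoints.map (lift (𝟙 Y) (𝟙 Y)) P = AlgPoints.map (snd X Y ⊗ₘ snd X Y) Q) :
    ∃ R : ComplexPoints ((X ⊗ X) ⊗ Y), AlgPoints.map (snd (X ⊗ X) Y) R = P ∧
      AlgPoints.map (lift (fst X X ▷ Y) (snd X X ▷ Y)) R = Q := by
  simp only [AlgPoints.map_apply] at h ⊢
  have e1 : P = Q ≫ fst _ _ ≫ snd X Y := by simpa using congrArg (· ≫ fst Y Y) h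
  have e2 : P = Q ≫ snd _ _ ≫ snd X Y := by simpa using congrArg (· ≫ snd Y Y) h
  have e3 : Q ≫ snd _ _ ≫ snd X Y = Q ≫ fst _ _ ≫ snd X Y := e2.symm.trans e1
  refine ⟨lift (Q ≫ (fst X Y ⊗ₘ fst X Y)) P, by simp, ?_⟩
  apply CartesianMonoidalCategory.hom_ext
  · apply CartesianMonoidalCategory.hom_ext
    · simp
    · simp [e1]
  · apply CartesianMonoidalCategory.hom_ext
    · simp
    · simp [e1, e3]

/-- **The fibre square `ι₁⁻¹(ι₂) = Δ_{X⊗Y}` on complex points**: `((x₁, x₂), y) ↦ ((x₁, y), (x₂, y))`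
and `(x, y₁, y₂) ↦ ((x, y₁), (x, y₂))` meet exactly in the points `((x, y), (x, y))`.
[cite: Fulton1998, Prop. 1.7 and Ex. 8.4.2] -/
theorem incidence_iota (P : ComplexPoints ((X ⊗ X) ⊗ Y)) (Q : ComplexPoints (X ⊗ (Y ⊗ Y)))
    (h : AlgPoints.map (lift (fst X X ▷ Y) (snd X X ▷ Y)) P =
      AlgPoints.map (lift (X ◁ fst Y Y) (X ◁ snd Y Y)) Q) :
    ∃ R : ComplexPoints (X ⊗ Y),
      AlgPoints.map (lift (lift (fst X Y) (fst X Y)) (snd X Y)) R = P ∧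
        AlgPoints.map (lift (fst X Y) (lift (snd X Y) (snd X Y))) R = Q := by
  simp only [AlgPoints.map_apply] at h ⊢
  have h11 : P ≫ fst _ _ ≫ fst X X = Q ≫ fst _ _ := by
    simpa using congrArg (· ≫ fst _ _ ≫ fst X Y) h
  have h12 : P ≫ snd _ _ = Q ≫ snd _ _ ≫ fst Y Y := by
    simpa using congrArg (· ≫ fst _ _ ≫ snd X Y) h
  have h21 : P ≫ fst _ _ ≫ snd X X = Q ≫ fst _ _ := by
    simpa using congrArg (· ≫ snd _ _ ≫ fst X Y) h
  have h22 : P ≫ snd _ _ = Q ≫ snd _ _ ≫ snd Y Y := by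
    simpa using congrArg (· ≫ snd _ _ ≫ snd X Y) h
  refine ⟨lift (Q ≫ fst _ _) (P ≫ snd _ _), ?_, ?_⟩
  · apply CartesianMonoidalCategory.hom_ext
    · apply CartesianMonoidalCategory.hom_ext
      · simp [h11]
      · simp [h21]
    · simp
  · apply CartesianMonoidalCategory.hom_ext
    · simp
    · apply CartesianMonoidalCategory.hom_ext
      · simp [h12.symm]
      · simp [h22.symm]

end Geometry

/-! ### §2 The three base changes -/

section BaseChange

/-- **`p₁₃^* cl(Δ_X) = K₁ · ι₁_* 1`** for ONE scalar `K₁`: clean base change (Fulton Thm. 6.2 (a)) for the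
fibre square `p₁₃⁻¹Δ_X = ι₁(X ⊗ (Y ⊗ Y))`, `ι₁ = (X ◁ fst, X ◁ snd)`, applied to `1 ∈ H⁰(X(ℂ))`.
[cite: Fulton1998, Thm. 6.2 (a), Prop. 1.7 and Ex. 8.4.2] -/
theorem exists_map_p13_diagonalClass_eq_smul (hX : IsSmoothProjective m X) (hY : IsSmoothProjective n Y) :
    ∃ K : ℂ, complexBetti.map (fst X Y ⊗ₘ fst X Y) (2 * m) (diagonalClass hX) =
      K • complexGysin complexOrientationFamily
        (Motives.IsSmoothProjective.tensor_holds hX (Motives.IsSmoothProjective.tensor_holds hY hY))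
        (Motives.IsSmoothProjective.tensor_holds (Motives.IsSmoothProjective.tensor_holds hX hY)
          (Motives.IsSmoothProjective.tensor_holds hX hY))
        (lift (X ◁ fst Y Y) (X ◁ snd Y Y))
        (show 0 + 2 * ((m + n) + (m + n)) = 2 * m + 2 * (m + (n + n)) by omega)
        (singularCohomology.one ℂ (ComplexPoints (X ⊗ (Y ⊗ Y)))) := by
  have hXX := Motives.IsSmoothProjective.tensor_holds hX hX
  have hXY := Motives.IsSmoothProjective.tensor_holds hX hY
  have hT := Motives.IsSmoothProjective.tensor_holds hXY hXY
  have hW := Motives.IsSmoothProjective.tensor_holds hX (Motives.IsSmoothProjective.tensor_holds hY hY)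
  haveI : IsClosedImmersion (lift (X ◁ fst Y Y) (X ◁ snd Y Y)).left :=
    isClosedImmersion_left_of_retraction hW hT _ _ (iota₁_comp_retraction X Y)
  haveI : IsClosedImmersion (lift (fst X (Y ⊗ Y)) (lift (X ◁ fst Y Y) (X ◁ snd Y Y))).left :=
    isClosedImmersion_lift_left_of_isClosedImmersion_right hX _ _
  obtain ⟨K, hK⟩ := complexGysin_cleanBaseChange complexOrientationFamily hX hXX hT hW
    (lift (𝟙 X) (𝟙 X)) (fst X Y ⊗ₘ fst X Y) (fst X (Y ⊗ Y)) (lift (X ◁ fst Y Y) (X ◁ snd Y Y))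
    (by omega) (fun P Q h ↦ incidence_p13 P Q h)
  refine ⟨K, ?_⟩
  rw [diagonalClass, hK (show 0 + 2 * (m + m) = 2 * m + 2 * m by omega), complexBetti.map,
    singularCohomology.map_one]

/-- **`p₂₄^* cl(Δ_Y) = K₂ · ι₂_* 1`** for ONE scalar `K₂` (the fibre square `p₂₄⁻¹Δ_Y = ι₂((X ⊗ X) ⊗ Y)`,
`ι₂ = (fst ▷ Y, snd ▷ Y)`). [cite: Fulton1998, Thm. 6.2 (a), Prop. 1.7 and Ex. 8.4.2] -/
theorem exists_map_p24_diagonalClass_eq_smul (hX : IsSmoothProjective m X) (hY : IsSmoothProjective n Y) :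
    ∃ K : ℂ, complexBetti.map (snd X Y ⊗ₘ snd X Y) (2 * n) (diagonalClass hY) =
      K • complexGysin complexOrientationFamily
        (Motives.IsSmoothProjective.tensor_holds (Motives.IsSmoothProjective.tensor_holds hX hX) hY)
        (Motives.IsSmoothProjective.tensor_holds (Motives.IsSmoothProjective.tensor_holds hX hY)
          (Motives.IsSmoothProjective.tensor_holds hX hY))
        (lift (fst X X ▷ Y) (snd X X ▷ Y))
        (show 0 + 2 * ((m + n) + (m + n)) = 2 * n + 2 * ((m + m) + n) by omega)
        (singularCohomology.one ℂ (ComplexPoints ((X ⊗ X) ⊗ Y))) := by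
  have hYY := Motives.IsSmoothProjective.tensor_holds hY hY
  have hXY := Motives.IsSmoothProjective.tensor_holds hX hY
  have hT := Motives.IsSmoothProjective.tensor_holds hXY hXY
  have hW := Motives.IsSmoothProjective.tensor_holds (Motives.IsSmoothProjective.tensor_holds hX hX) hY
  haveI : IsClosedImmersion (lift (fst X X ▷ Y) (snd X X ▷ Y)).left :=
    isClosedImmersion_left_of_retraction hW hT _ _ (iota₂_comp_retraction X Y)
  haveI : IsClosedImmersion (lift (snd (X ⊗ X) Y) (lift (fst X X ▷ Y) (snd X X ▷ Y))).left :=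
    isClosedImmersion_lift_left_of_isClosedImmersion_right hY _ _
  obtain ⟨K, hK⟩ := complexGysin_cleanBaseChange complexOrientationFamily hY hYY hT hW
    (lift (𝟙 Y) (𝟙 Y)) (snd X Y ⊗ₘ snd X Y) (snd (X ⊗ X) Y) (lift (fst X X ▷ Y) (snd X X ▷ Y))
    (by omega) (fun P Q h ↦ incidence_p24 P Q h)
  refine ⟨K, ?_⟩
  rw [diagonalClass, hK (show 0 + 2 * (n + n) = 2 * n + 2 * n by omega), complexBetti.map,
    singularCohomology.map_one]

/-- **`ι₂_* 1 ∪ ι₁_* 1 = K₃ · cl(Δ_{X⊗Y})`** for ONE scalar `K₃`: by the projection formula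
`ι₂_* 1 ∪ ι₁_* 1 = ι₁_*(ι₁^*(ι₂_* 1))`, clean base change for the fibre square `ι₁⁻¹(ι₂) = Δ_{X⊗Y}`
(`ι₁^* ι₂_* 1 = K₃ · p₃_* 1`, `p₃ = (fst, (snd, snd))`), and `p₃ ≫ ι₁ = Δ_{X⊗Y}` — the transversal
intersection `p₁₃⁻¹Δ_X ∩ p₂₄⁻¹Δ_Y = Δ_{X×Y}`. [cite: Fulton1998, Thm. 6.2 (a), Prop. 8.1.1 and Ex. 8.4.2]
[cite: FultonYoungTableaux1997, Appendix B §B.1 (5)–(7)] -/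
theorem exists_gysin_iota_one_cup_eq_smul_diagonalClass (hX : IsSmoothProjective m X)
    (hY : IsSmoothProjective n Y) :
    ∃ K : ℂ, cupProduct (show 2 * n + 2 * m = 2 * (m + n) by omega)
      (complexGysin complexOrientationFamily
        (Motives.IsSmoothProjective.tensor_holds (Motives.IsSmoothProjective.tensor_holds hX hX) hY)
        (Motives.IsSmoothProjective.tensor_holds (Motives.IsSmoothProjective.tensor_holds hX hY)
          (Motives.IsSmoothProjective.tensor_holds hX hY))
        (lift (fst X X ▷ Y) (snd X X ▷ Y))
        (show 0 + 2 * ((m + n) + (m + n)) = 2 * n + 2 * ((m + m) + n) by omega)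
        (singularCohomology.one ℂ (ComplexPoints ((X ⊗ X) ⊗ Y))))
      (complexGysin complexOrientationFamily
        (Motives.IsSmoothProjective.tensor_holds hX (Motives.IsSmoothProjective.tensor_holds hY hY))
        (Motives.IsSmoothProjective.tensor_holds (Motives.IsSmoothProjective.tensor_holds hX hY)
          (Motives.IsSmoothProjective.tensor_holds hX hY))
        (lift (X ◁ fst Y Y) (X ◁ snd Y Y))
        (show 0 + 2 * ((m + n) + (m + n)) = 2 * m + 2 * (m + (n + n)) by omega)
        (singularCohomology.one ℂ (ComplexPoints (X ⊗ (Y ⊗ Y))))) =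
      K • diagonalClass (Motives.IsSmoothProjective.tensor_holds hX hY) := by
  have hμ : complexOrientationFamily.HasPoincareDuality := hasPoincareDuality_complexOrientationFamily
  have hXY := Motives.IsSmoothProjective.tensor_holds hX hY
  have hT := Motives.IsSmoothProjective.tensor_holds hXY hXY
  have hW₁ := Motives.IsSmoothProjective.tensor_holds hX (Motives.IsSmoothProjective.tensor_holds hY hY)
  have hW₂ := Motives.IsSmoothProjective.tensor_holds (Motives.IsSmoothProjective.tensor_holds hX hX) hY
  -- the fibre square `ι₁⁻¹(ι₂) = Δ`
  haveI : IsClosedImmersion (lift (lift (fst X Y) (fst X Y)) (snd X Y)).left :=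
    isClosedImmersion_left_of_retraction hXY hW₂ _ _ (diagFst_comp_retraction X Y)
  haveI : IsClosedImmersion (lift (lift (lift (fst X Y) (fst X Y)) (snd X Y))
      (lift (fst X Y) (lift (snd X Y) (snd X Y)))).left :=
    isClosedImmersion_lift_left_of_isSmoothProjective hW₁ _ _
  obtain ⟨K, hK⟩ := complexGysin_cleanBaseChange complexOrientationFamily hW₂ hT hW₁ hXY
    (lift (fst X X ▷ Y) (snd X X ▷ Y)) (lift (X ◁ fst Y Y) (X ◁ snd Y Y))
    (lift (lift (fst X Y) (fst X Y)) (snd X Y)) (lift (fst X Y) (lift (snd X Y) (snd X Y)))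
    (by omega) (fun P Q h ↦ incidence_iota P Q h)
  refine ⟨K, ?_⟩
  -- projection formula for `ι₁`: `ι₂_* 1 ∪ ι₁_* 1 = ι₁_*(ι₁^*(ι₂_* 1) ∪ 1)`
  rw [← complexGysin_cup hμ hW₁ hT (lift (X ◁ fst Y Y) (X ◁ snd Y Y)) (Nat.add_zero (2 * n))
      (show 2 * n + 2 * ((m + n) + (m + n)) = 2 * (m + n) + 2 * (m + (n + n)) by omega)
      (show 0 + 2 * ((m + n) + (m + n)) = 2 * m + 2 * (m + (n + n)) by omega)
      (show 2 * n + 2 * m = 2 * (m + n) by omega),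
    cupProduct_one, hK (show 0 + 2 * ((m + n) + (m + n)) = 2 * n + 2 * ((m + m) + n) by omega),
    complexBetti.map, singularCohomology.map_one, map_smul,
    ← LinearMap.comp_apply (f := complexGysin complexOrientationFamily hW₁ hT _ _),
    ← complexGysin_comp hμ hXY hW₁ hT (lift (fst X Y) (lift (snd X Y) (snd X Y)))
      (lift (X ◁ fst Y Y) (X ◁ snd Y Y))
      (show 0 + 2 * (m + (n + n)) = 2 * n + 2 * (m + n) by omega)
      (show 2 * n + 2 * ((m + n) + (m + n)) = 2 * (m + n) + 2 * (m + (n + n)) by omega),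
    diagSnd_comp_iota₁]
  rfl

end BaseChange

/-! ### §3 Non-vanishing: cross products of non-zero classes, `cl(Δ) ≠ 0` -/

section NeZero

/-- **A cross product of non-zero classes is non-zero**: for `X`, `Z` smooth projective, `a ∈ Hᵏ(X(ℂ))`,
`b ∈ Hʲ(Z(ℂ))` both non-zero, `pr_X^* a ∪ pr_Z^* b ≠ 0` — choose `b'` with `b ∪ b' ≠ 0` in the top
degree of `Z` (perfectness of the cup pairing, `eq_zero_of_forall_cupPairing_eq_zero`); then
`(pr_X^* a ∪ pr_Z^* b) ∪ pr_Z^* b' = pr_X^* a ∪ pr_Z^*(b ∪ b') ≠ 0` by the tree's top-degree case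
`cupProduct_map_fst_map_snd_ne_zero`. [cite: HatcherAT2002, §3.3 Prop. 3.38 and §3.2 Thm. 3.16] -/
theorem cupProduct_map_fst_map_snd_ne_zero_of_ne_zero {l : ℕ} {Z : Motives.SchemeOver ℂ}
    (hX : IsSmoothProjective l X) (hZ : IsSmoothProjective n Z) {k j s : ℕ} (hkj : k + j = s)
    {a : complexBetti X k} (ha : a ≠ 0) {b : complexBetti Z j} (hb : b ≠ 0) :
    cupProduct hkj (complexBetti.map (fst X Z) k a) (complexBetti.map (snd X Z) j b) ≠ 0 := by
  -- `b` lives in degree `≤ 2n`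
  have hj : j ≤ 2 * n := by
    by_contra hj
    haveI := subsingleton_complexBetti hZ (show 2 * n < j by omega)
    exact hb (Subsingleton.elim _ _)
  -- a partner `b'` with `b ∪ b' ≠ 0`
  have key : ¬ ∀ b' : complexBetti Z (2 * n - j),
      cupProduct (show j + (2 * n - j) = 2 * n by omega) b b' = 0 := fun hall ↦
    hb (eq_zero_of_forall_cupPairing_eq_zero complexOrientationFamily hZ
      (show j + (2 * n - j) = 2 * n by omega) fun b' ↦ by
        rw [cupPairing_apply, hall b', map_zero, LinearMap.zero_apply])
  obtain ⟨b', hb'⟩ := not_forall.1 key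
  intro h0
  have h1 := cupProduct_map_fst_map_snd_ne_zero complexOrientationFamily hX hZ
    (show k + 2 * n = s + (2 * n - j) by omega) ha hb'
  apply h1
  rw [complexBetti.map, cupProduct_map, ← complexBetti.map, ← complexBetti.map,
    ← cupProduct_assoc hkj (show j + (2 * n - j) = 2 * n by omega)
      (show s + (2 * n - j) = s + (2 * n - j) from rfl) (show k + 2 * n = s + (2 * n - j) by omega),
    h0, LinearMap.map_zero₂]

/-- **`cl(Δ) ≠ 0`**: the class of the diagonal acts as the identity on `H⁰(X(ℂ); ℂ) ∋ 1 ≠ 0`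
(`corrAction_diagonalClass_apply`). [cite: Fulton1998, §16.1 Ex. 16.1.11] -/
theorem diagonalClass_ne_zero (hX : IsSmoothProjective n X) : diagonalClass hX ≠ 0 := by
  intro h
  have h1 := corrAction_diagonalClass_apply hX (rfl : 0 + 2 * n = 0 + 2 * n)
    (singularCohomology.one ℂ (ComplexPoints X))
  rw [h, map_zero, LinearMap.zero_apply] at h1
  exact complexBetti_one_ne_zero hX h1.symm

/-- The shuffle `(p₁₃, p₂₄) : (X ⊗ Y) ⊗ (X ⊗ Y) ⟶ (X ⊗ X) ⊗ (Y ⊗ Y)` followed by the inverse shuffle is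
the identity. [cite: Kahn2020, §6.9 proof of Lemma 6.30] -/
@[reassoc]
theorem shuffle_comp_unshuffle (X Y : Motives.SchemeOver ℂ) :
    lift (fst X Y ⊗ₘ fst X Y) (snd X Y ⊗ₘ snd X Y) ≫
        lift (lift (fst (X ⊗ X) (Y ⊗ Y) ≫ fst X X) (snd (X ⊗ X) (Y ⊗ Y) ≫ fst Y Y))
          (lift (fst (X ⊗ X) (Y ⊗ Y) ≫ snd X X) (snd (X ⊗ X) (Y ⊗ Y) ≫ snd Y Y)) =
      𝟙 ((X ⊗ Y) ⊗ (X ⊗ Y)) := by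
  ext <;> simp

/-- The inverse shuffle followed by the shuffle is the identity. [cite: Kahn2020, §6.9 proof of Lemma 6.30] -/
@[reassoc]
theorem unshuffle_comp_shuffle (X Y : Motives.SchemeOver ℂ) :
    lift (lift (fst (X ⊗ X) (Y ⊗ Y) ≫ fst X X) (snd (X ⊗ X) (Y ⊗ Y) ≫ fst Y Y))
        (lift (fst (X ⊗ X) (Y ⊗ Y) ≫ snd X X) (snd (X ⊗ X) (Y ⊗ Y) ≫ snd Y Y)) ≫
        lift (fst X Y ⊗ₘ fst X Y) (snd X Y ⊗ₘ snd X Y) =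
      𝟙 ((X ⊗ X) ⊗ (Y ⊗ Y)) := by
  ext <;> simp

/-- **`p₁₃^* α ∪ p₂₄^* β` is the pull-back along the shuffle of the cross product `pr^* α ∪ pr^* β` on
`(X ⊗ X) ⊗ (Y ⊗ Y)`** (`p₁₃ = shuffle ≫ fst`, `p₂₄ = shuffle ≫ snd`). [cite: Kahn2020, §6.9 proof of Lemma 6.30]
[cite: HatcherAT2002, §3.2 Prop. 3.10] -/
theorem map_shuffle_cross {i j k : ℕ} (h : i + j = k) (α : complexBetti (X ⊗ X) i)
    (β : complexBetti (Y ⊗ Y) j) :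
    complexBetti.map (lift (fst X Y ⊗ₘ fst X Y) (snd X Y ⊗ₘ snd X Y)) k
        (cupProduct h (complexBetti.map (fst (X ⊗ X) (Y ⊗ Y)) i α)
          (complexBetti.map (snd (X ⊗ X) (Y ⊗ Y)) j β)) =
      cupProduct h (complexBetti.map (fst X Y ⊗ₘ fst X Y) i α)
        (complexBetti.map (snd X Y ⊗ₘ snd X Y) j β) := by
  rw [complexBetti.map, cupProduct_map, ← complexBetti.map, ← complexBetti.map,
    ← ModuleCat.comp_apply, ← complexBetti.map_comp, lift_fst, ← ModuleCat.comp_apply,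
    ← complexBetti.map_comp, lift_snd]

/-- Pull-back along the shuffle is injective (the shuffle is an isomorphism). [cite: Kahn2020, §6.9 proof of Lemma 6.30] -/
theorem complexBetti_map_shuffle_injective (k : ℕ) :
    Function.Injective
      (complexBetti.map (lift (fst X Y ⊗ₘ fst X Y) (snd X Y ⊗ₘ snd X Y)) k) := by
  intro z z' h
  have key := congrArg (complexBetti.map
    (lift (lift (fst (X ⊗ X) (Y ⊗ Y) ≫ fst X X) (snd (X ⊗ X) (Y ⊗ Y) ≫ fst Y Y))
      (lift (fst (X ⊗ X) (Y ⊗ Y) ≫ snd X X) (snd (X ⊗ X) (Y ⊗ Y) ≫ snd Y Y))) k) h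
  rwa [← ModuleCat.comp_apply, ← complexBetti.map_comp, unshuffle_comp_shuffle, complexBetti.map_id,
    ModuleCat.id_apply, ← ModuleCat.comp_apply, ← complexBetti.map_comp, unshuffle_comp_shuffle,
    complexBetti.map_id, ModuleCat.id_apply] at key

/-- **`p₁₃^* cl(Δ_X) ∪ p₂₄^* cl(Δ_Y) ≠ 0`.** [cite: Fulton1998, Ex. 8.4.2 and §16.1 Ex. 16.1.11] -/
theorem p13_diagonalClass_cup_p24_diagonalClass_ne_zero (hX : IsSmoothProjective m X)
    (hY : IsSmoothProjective n Y) :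
    cupProduct (show 2 * m + 2 * n = 2 * (m + n) by omega)
        (complexBetti.map (fst X Y ⊗ₘ fst X Y) (2 * m) (diagonalClass hX))
        (complexBetti.map (snd X Y ⊗ₘ snd X Y) (2 * n) (diagonalClass hY)) ≠ 0 := by
  rw [← map_shuffle_cross]
  intro h
  have h' := complexBetti_map_shuffle_injective (X := X) (Y := Y) (2 * (m + n)) (h.trans (map_zero _).symm)
  exact cupProduct_map_fst_map_snd_ne_zero_of_ne_zero (Motives.IsSmoothProjective.tensor_holds hX hX)
    (Motives.IsSmoothProjective.tensor_holds hY hY) _ (diagonalClass_ne_zero hX) (diagonalClass_ne_zero hY) h'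

end NeZero

/-! ### §4 `cl(Δ_{X⊗Y}) = c · p₁₃^* cl(Δ_X) ∪ p₂₄^* cl(Δ_Y)`, `c ≠ 0` -/

section Product

/-- **`p₁₃^* cl(Δ_X) ∪ p₂₄^* cl(Δ_Y) = C · cl(Δ_{X⊗Y})` with `C ≠ 0`** (complex orientations): §2 gives
`p₁₃^* cl(Δ_X) ∪ p₂₄^* cl(Δ_Y) = K₁K₂ · ι₁_* 1 ∪ ι₂_* 1 = K₁K₂K₃ · cl(Δ_{X⊗Y})` (the degrees `2m`, `2n`
are even, so `ι₁_* 1 ∪ ι₂_* 1 = ι₂_* 1 ∪ ι₁_* 1`), and the left-hand side is non-zero (§3).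
Classically `C = 1`: "`[Δ_{X×Y}] = p₁₃^*[Δ_X] · p₂₄^*[Δ_Y]`". [cite: Fulton1998, Ex. 8.4.2, Prop. 8.1.1 and §16.1 Ex. 16.1.11]
[cite: Kahn2020, §6.9 proof of Lemma 6.30 (3)] -/
theorem exists_p13_diagonalClass_cup_p24_diagonalClass_eq_smul (hX : IsSmoothProjective m X)
    (hY : IsSmoothProjective n Y) :
    ∃ C : ℂ, C ≠ 0 ∧
      cupProduct (show 2 * m + 2 * n = 2 * (m + n) by omega)
          (complexBetti.map (fst X Y ⊗ₘ fst X Y) (2 * m) (diagonalClass hX))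
          (complexBetti.map (snd X Y ⊗ₘ snd X Y) (2 * n) (diagonalClass hY)) =
        C • diagonalClass (Motives.IsSmoothProjective.tensor_holds hX hY) := by
  obtain ⟨K₁, hK₁⟩ := exists_map_p13_diagonalClass_eq_smul hX hY
  obtain ⟨K₂, hK₂⟩ := exists_map_p24_diagonalClass_eq_smul hX hY
  obtain ⟨K₃, hK₃⟩ := exists_gysin_iota_one_cup_eq_smul_diagonalClass hX hY
  have key : cupProduct (show 2 * m + 2 * n = 2 * (m + n) by omega)
      (complexBetti.map (fst X Y ⊗ₘ fst X Y) (2 * m) (diagonalClass hX))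
      (complexBetti.map (snd X Y ⊗ₘ snd X Y) (2 * n) (diagonalClass hY)) =
      (K₁ * K₂ * K₃) • diagonalClass (Motives.IsSmoothProjective.tensor_holds hX hY) := by
    rw [hK₁, hK₂, LinearMap.map_smul₂, map_smul,
      cupProduct_gradedComm_holds ℂ _ (show 2 * m + 2 * n = 2 * (m + n) by omega)
        (show 2 * n + 2 * m = 2 * (m + n) by omega),
      Even.neg_one_pow (⟨2 * m * n, by ring⟩ : Even (2 * m * (2 * n))), one_smul, hK₃, smul_smul,
      smul_smul]
  refine ⟨K₁ * K₂ * K₃, ?_, key⟩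
  intro hC
  rw [hC, zero_smul] at key
  exact p13_diagonalClass_cup_p24_diagonalClass_ne_zero hX hY key

/-- **`cl(Δ_{X⊗Y}) = c · p₁₃^* cl(Δ_X) ∪ p₂₄^* cl(Δ_Y)` with `c ≠ 0`** — the class of the diagonal of a
product in terms of the diagonals of the factors (complex orientations; classically `c = 1`).
[cite: Fulton1998, Ex. 8.4.2 and §16.1 Ex. 16.1.11] [cite: Kahn2020, §6.9 proof of Lemma 6.30 (3)] -/
theorem exists_diagonalClass_tensor_eq_smul (hX : IsSmoothProjective m X) (hY : IsSmoothProjective n Y) :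
    ∃ c : ℂ, c ≠ 0 ∧ diagonalClass (Motives.IsSmoothProjective.tensor_holds hX hY) =
      c • cupProduct (show 2 * m + 2 * n = 2 * (m + n) by omega)
        (complexBetti.map (fst X Y ⊗ₘ fst X Y) (2 * m) (diagonalClass hX))
        (complexBetti.map (snd X Y ⊗ₘ snd X Y) (2 * n) (diagonalClass hY)) := by
  obtain ⟨C, hC, h⟩ := exists_p13_diagonalClass_cup_p24_diagonalClass_eq_smul hX hY
  exact ⟨C⁻¹, inv_ne_zero hC, by rw [h, smul_smul, inv_mul_cancel₀ hC, one_smul]⟩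

end Product

end Literature.AlgebraicGeometry.HodgeTheory

end
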